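import Summits.HubbardSuperconductivity.HubbardSuperconductivity.Theses.LogColdTorus
import Summits.HubbardSuperconductivity.HubbardSuperconductivity.Theorems.AbelianDualityThermalToGroundAverage
import Mathlib.Analysis.Complex.ExponentialBounds
import HarnessLib

/-!
# Route `LogColdTorus`, crux `LogColdDWaveOrder` (stmt-HubbardSuperconductivity-8807):
# the log-cold crux is IMPLIED by route `AbelianDuality`'s fixed-`β` BKT bound

`logColdDWaveOrder_of_sectorDWaveBKTBound : SectorDWaveBKTBound → LogColdDWaveOrder` — an edge
between two open cruxes of two routes, both read BY NAME:

* hypothesis `Summit.….Theses.AbelianDuality.SectorDWaveBKTBound` (stmt-HubbardSuperconductivity-1636,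
  the `T > 0` companion saturating Koma–Tasaki): on a `(U, δ)` window, for all `β ≥ β₀`, even
  `L ≥ L₀` and torus sites at distance `≥ R₀`, `c (dist+1)^{-C/β} ≤ Re ω^{sec}_{β,L}((P_x)† P_y)` in the
  canonical `(N_L, S^z = 0)` sector (a BKT power-law LOWER bound at fixed temperature, uniform in `L`);
* conclusion `Summit.….Theses.LogColdTorus.LogColdDWaveOrder` (stmt-HubbardSuperconductivity-8807):
  log-cold sector `d`-wave order `(c/4)·L⁴ ≤ Re ω^{sec}_{κ log L, L}(Δ_d†Δ_d)` for every `κ ≥ κ₀`,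
  eventually in even `L`, uniformly on the same window.

Proof: read the BKT bound AT the log-cold temperature `β_L = κ log L`. For `κ ≥ κ₀ := 4C / log 2`
and `L ≥ 2` one has `β_L ≥ C (log L + 1)/log 2`, so every far pair carries `Re ω ≥ c (dist+1)^{-C/β_L}
≥ c/2` (`half_le_rpow_neg_div`); near pairs cost at most `(c/2 + K²)(2R₀+1)² L²`
(`re_gibbs_pairIntensity_toBlock_ge`, the summation lemma of `ThermalToGroundAverage`); the threshold
`L² ≥ (4/c)(c/2 + K²)(2R₀+1)²` leaves `(c/4) L⁴`; `β_L ≥ β₀` once `L ≥ e^{β₀/κ}`. So the rank-2 bet of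
route `LogColdTorus` is logically DOWNSTREAM of the rank-4 BKT crux of route `AbelianDuality`: the
log-cold crux is the weaker statement (Mermin–Wagner's log is a constant at `β = κ log L`, so a
fixed-`β` power law `L^{-C/β}` read there is an `L`-independent constant `e^{-C/κ}`).

Sources: T. Koma, H. Tasaki, PRL 68 (1992) 3248 (p. 3: "the slowest possible decay is of KT type");
J. Fröhlich, T. Spencer, CMP 81 (1981) 527 (the classical BKT lower bound of this shape). No definitions.
-/

-- the mandated namespace `Summit.<Summit>.<Problem>.Theorems` repeats `HubbardSuperconductivity`
-- (single-problem summit, D-0017), which the `dupNamespace` linter flags on every declaration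
set_option linter.dupNamespace false

noncomputable section

namespace Summit.HubbardSuperconductivity.HubbardSuperconductivity.Theorems.LogColdTorus

open Matrix Finset Literature.MathematicalPhysics.QuantumLattice Literature.Probability.LatticeModels
  Summit.HubbardSuperconductivity.HubbardSuperconductivity.Theorems
open scoped Matrix.Norms.L2Operator ComplexOrder Classical

/-- **`SectorDWaveBKTBound → LogColdDWaveOrder`** (registered sub-goal
`logColdDWaveOrder_of_sectorDWaveBKTBound` of crux stmt-HubbardSuperconductivity-8807): route
`AbelianDuality`'s fixed-`β` BKT lower bound on the sector pair correlations (crux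
stmt-HubbardSuperconductivity-1636), read at `β_L = κ log L` with `κ ≥ 4C/log 2`, gives the log-cold
`d`-wave order of route `LogColdTorus` with the same `δ`, the same window, `κ₀ = 4C/log 2` and order
constant `c/4`. [cite: KomaTasakiPRL1992, p. 3] -/
theorem logColdDWaveOrder_of_sectorDWaveBKTBound :
    Summit.HubbardSuperconductivity.HubbardSuperconductivity.Theses.AbelianDuality.SectorDWaveBKTBound →
      Summit.HubbardSuperconductivity.HubbardSuperconductivity.Theses.LogColdTorus.LogColdDWaveOrder := by
  rintro ⟨δ, hδ, U₁, U₂, hU₁, hU₁₂, β₀, c, C, hβ₀, hc, hC, R₀, L₀, hBKT⟩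
  set K : ℝ := 2 * ∑ e ∈ insert (0 : Site 2) unitSteps, |dWaveFormFactor e / Real.sqrt 2| with hK
  set Mn : ℕ := (2 * R₀ + 1) ^ 2 with hMn
  set T : ℝ := 4 / c * ((c / 2 + K ^ 2) * (Mn : ℝ)) with hT
  have hlog2 : (0.6931471803 : ℝ) < Real.log 2 := Real.log_two_gt_d9
  have hlog2pos : 0 < Real.log 2 := by linarith
  refine ⟨δ, hδ, U₁, U₂, hU₁, hU₁₂, 4 * C / Real.log 2, c / 4, by positivity, by positivity, ?_⟩
  intro κ hκ
  have hκpos : 0 < κ := lt_of_lt_of_le (by positivity) hκ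
  refine ⟨max (max L₀ (⌈T⌉₊ + 1)) (max 2 (⌈Real.exp (β₀ / κ)⌉₊ + 1)), ?_⟩
  intro U hU L _ hL hEv p
  have hL0 : L₀ ≤ L := (le_max_left _ _).trans ((le_max_left _ _).trans hL)
  have hLT : ⌈T⌉₊ + 1 ≤ L := (le_max_right _ _).trans ((le_max_left _ _).trans hL)
  have hL2 : 2 ≤ L := (le_max_left _ _).trans ((le_max_right _ _).trans hL)
  have hLexp : ⌈Real.exp (β₀ / κ)⌉₊ + 1 ≤ L := (le_max_right _ _).trans ((le_max_right _ _).trans hL)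
  have hL2r : (2 : ℝ) ≤ (L : ℝ) := by exact_mod_cast hL2
  have hLpos : (0 : ℝ) < (L : ℝ) := by linarith
  have hH : ((hubbardTorus 2 L 1 U).toBlock p p).IsHermitian :=
    (hubbardTorus_isHermitian (hamiltonian_isHermitian_and_commute_holds _) 1 U).submatrix _
  -- the log-cold temperature
  set β : ℝ := κ * Real.log L with hβ
  have hlogL : Real.log 2 ≤ Real.log L := Real.log_le_log two_pos hL2r
  have hlogLpos : 0 < Real.log L := hlog2pos.trans_le hlogL
  -- `β ≥ β₀` (from `L ≥ e^{β₀/κ}`)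
  have hβ0 : β₀ ≤ β := by
    have h1 : Real.exp (β₀ / κ) ≤ (L : ℝ) := by
      have h2 : Real.exp (β₀ / κ) ≤ (⌈Real.exp (β₀ / κ)⌉₊ : ℝ) := Nat.le_ceil _
      have h3 : ((⌈Real.exp (β₀ / κ)⌉₊ + 1 : ℕ) : ℝ) ≤ (L : ℝ) := by exact_mod_cast hLexp
      push_cast at h3
      linarith
    have h4 : β₀ / κ ≤ Real.log L := by
      rw [← Real.log_exp (β₀ / κ)]
      exact Real.log_le_log (Real.exp_pos _) h1
    have h5 := mul_le_mul_of_nonneg_left h4 hκpos.le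
    rw [mul_div_cancel₀ _ hκpos.ne'] at h5
    exact h5
  -- `β ≥ C (log L + 1)/log 2` (from `κ ≥ 4C/log 2` and `log L ≥ log 2 > 1/3`)
  have hβ1 : C * (Real.log (L : ℝ) + 1) / Real.log 2 ≤ β := by
    rw [div_le_iff₀ hlog2pos, hβ]
    have h1 : 4 * C / Real.log 2 * Real.log 2 = 4 * C := div_mul_cancel₀ _ hlog2pos.ne'
    have h2 : 4 * C * Real.log L ≤ κ * Real.log L * Real.log 2 := by
      have := mul_le_mul_of_nonneg_right hκ (mul_nonneg hlogLpos.le hlog2pos.le)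
      calc 4 * C * Real.log L = 4 * C / Real.log 2 * Real.log 2 * Real.log L := by rw [h1]
        _ = 4 * C / Real.log 2 * (Real.log L * Real.log 2) := by ring
        _ ≤ κ * (Real.log L * Real.log 2) := this
        _ = κ * Real.log L * Real.log 2 := by ring
    have h3 : Real.log L + 1 ≤ 4 * Real.log L := by linarith
    nlinarith
  -- far pairs: `c/2 ≤ Re ω`
  have hfar : ∀ x y : TorusSite 2 L, R₀ ≤ torusDist x y →
      c / 2 ≤ (Matrix.gibbsState β ((hubbardTorus 2 L 1 U).toBlock p p)
        ((((localPair dWaveFormFactor L x)ᴴ * localPair dWaveFormFactor L y)).toBlock p p)).re := by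
    intro x y hxy
    have h := hBKT U hU β hβ0 L hL0 hEv x y hxy
    dsimp only at h
    have hd1 : (1 : ℝ) ≤ (torusDist x y : ℝ) + 1 := by
      have : (0 : ℝ) ≤ (torusDist x y : ℝ) := Nat.cast_nonneg _
      linarith
    have hdL : (torusDist x y : ℝ) + 1 ≤ (L : ℝ) := by
      have := torusDist_lt x y
      exact_mod_cast this
    have hhalf := half_le_rpow_neg_div hd1 hdL hC hβ1
    have : c / 2 ≤ c * ((torusDist x y : ℝ) + 1) ^ (-C / β) := by
      have := mul_le_mul_of_nonneg_left hhalf hc.le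
      linarith
    exact this.trans h
  have hsum := re_gibbs_pairIntensity_toBlock_ge L hH β c hc.le R₀ hfar
  -- threshold arithmetic: `(c/4) L⁴ ≤ (c/2) L⁴ - (c/2 + K²) Mn L²`
  have hLreal : T ≤ (L : ℝ) := by
    have h1 : T ≤ (⌈T⌉₊ : ℝ) := Nat.le_ceil T
    have h2 : ((⌈T⌉₊ + 1 : ℕ) : ℝ) ≤ (L : ℝ) := by exact_mod_cast hLT
    push_cast at h2
    linarith
  have hL1 : (1 : ℝ) ≤ (L : ℝ) := by linarith
  have hLsq : T ≤ (L : ℝ) ^ 2 := hLreal.trans (by nlinarith)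
  have hkey : c / 4 * (L : ℝ) ^ 4 ≤
      c / 2 * (L : ℝ) ^ 4 - (c / 2 + K ^ 2) * (Mn : ℝ) * (L : ℝ) ^ 2 := by
    have h1 : (c / 2 + K ^ 2) * (Mn : ℝ) ≤ c / 4 * (L : ℝ) ^ 2 := by
      rw [hT] at hLsq
      have h := mul_le_mul_of_nonneg_left hLsq (show 0 ≤ c / 4 by positivity)
      have h' : c / 4 * (4 / c * ((c / 2 + K ^ 2) * (Mn : ℝ))) = (c / 2 + K ^ 2) * (Mn : ℝ) := by
        field_simp
      linarith
    have hL2nn : 0 ≤ (L : ℝ) ^ 2 := by positivity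
    nlinarith
  exact hkey.trans hsum

end Summit.HubbardSuperconductivity.HubbardSuperconductivity.Theorems.LogColdTorus

end
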